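import Literature.Analysis.FluidPDE.NSBoundedSpatialHolder
import Literature.Analysis.FunctionSpaces.MollificationLocal
import HarnessLib

/-!
# The weak product rule behind `-div (v ⊗ v) = -(v·∇)v` for bounded Sobolev fields on a ball

Analysis/FluidPDE proof file on the decomposition path of the named fact
`Literature.Analysis.FluidPDE.SereginSverak2009.LocalHolderBound`
(`FluidPDE/SereginSverakBlowup`; Seregin–Šverák 2009, §4, arXiv:0804.1803 p. 11). The printed
argument passes from the Navier–Stokes identity to "the nonhomogeneous Stokes system (p12) …
where `f^k = -u^k·∇u^k`", i.e. it identifies the distribution `-div (u ⊗ u)` with the function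
`-(u·∇)u = -(∇u) u` for a bounded field with an integrable weak gradient. This file proves the
slice-wise (purely spatial) form of that identification:

* `setIntegral_inner_fderiv_apply_self_eq_neg` — for `v ∈ L^∞(B)` on a ball `B ⊆ ℝ³` with an
  integrable weak gradient `g = ∇v` (`HasWeakFDerivOn`) whose trace vanishes a.e. (`v` weakly
  divergence free) and a test field `φ ∈ C_c^∞(B; ℝ³)`,
  `∫_B ⟪v, Dφ(v)⟫ = -∫_B ⟪g v, φ⟫`.

Proof (Gilbarg–Trudinger 2001, §7.3, the product formula (7.18), specialised and made
quantitative for a bounded factor): mollify the zero extension `𝟙_B v` into smooth fields `wₙ`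
(`FunctionSpaces/Mollification`, `FunctionSpaces/MollificationLocal`), which are bounded by the
same constant, converge to `v` a.e. on `B`, and are divergence free on `supp φ` for large `n`
(`traceCoord_fderiv_mollified_eq_zero`: `tr D(k ⋆ 𝟙_B v)(x) = ∫ k(x - y) tr g(y) dy = 0`); the
weak-derivative identity of `vᵢ` tested with the test functions `(wₙ)ⱼ φᵢ` and summed over
`i, j` gives `∫ (⟪v, Dφ(wₙ)⟫ + tr(Dwₙ) ⟪v, φ⟫ + ⟪g wₙ, φ⟫) = 0`
(`integrableOn_and_setIntegral_productRule`), and dominated convergence concludes. The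
space–time consequence for distributional Navier–Stokes solutions is in
`FluidPDE/NSConvectiveStokesForm`.

## References

* D. Gilbarg, N. S. Trudinger, *Elliptic partial differential equations of second order* (2001),
  §7.3, (7.18). [`GilbargTrudinger2001`]
* G. Seregin, V. Šverák, Comm. PDE 34 (2009) = arXiv:0804.1803, §4 p. 11, (p12).
  [`SereginSverak2009`]
* L. C. Evans, *Partial Differential Equations* (2010), §5.3.1, App. C.4. [`Evans2010`]
-/

noncomputable section

open MeasureTheory TopologicalSpace Set Function Metric Filter
open scoped Laplacian InnerProductSpace RealInnerProductSpace ENNReal NNReal Topology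

namespace Literature.Analysis.FluidPDE

/-! ## The Navier–Stokes nonlinearity of a bounded field with an integrable weak gradient:
`∫ ⟪v, (v·∇)φ⟫ = -∫ ⟪(∇v) v, φ⟫` on a ball (weak product rule) -/

section ConvSlice

open FunctionSpaces SerrinBoundedHolder
open scoped Convolution

/-- Local notation for physical space `ℝ³ = EuclideanSpace ℝ (Fin 3)`. -/
local notation "ℝ³" => EuclideanSpace ℝ (Fin 3)

/-- Local notation for the standard basis vectors of `ℝ³`. -/
local notation "𝐞" j => EuclideanSpace.single (j : Fin 3) (1 : ℝ)

/-! ### Small calculus and measurability helpers -/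

/-- The derivative of a coordinate is the coordinate of the derivative. [folklore] -/
theorem fderiv_coord_apply {f : ℝ³ → ℝ³} {x : ℝ³} (hf : DifferentiableAt ℝ f x) (i : Fin 3)
    (a : ℝ³) : fderiv ℝ (fun y => f y i) x a = fderiv ℝ f x a i := by
  have h := (hasFDerivWithinAt_euclidean.1 (hf.hasFDerivAt.hasFDerivWithinAt (s := univ))) i
  rw [(hasFDerivWithinAt_univ.1 h).fderiv]
  rfl

/-- Coordinates of a test field are test functions. [folklore] -/
theorem isTestFunctionOn_coord {U : Opens ℝ³} {φ : ℝ³ → ℝ³} (hφ : IsTestFunctionOn U φ)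
    (i : Fin 3) : IsTestFunctionOn U fun y => φ y i := by
  have hs : support (fun y => φ y i) ⊆ support φ := fun x hx h0 => hx (by simp [h0])
  exact ⟨contDiff_euclidean.1 hφ.contDiff i, hφ.hasCompactSupport.mono hs,
    (closure_mono hs).trans hφ.tsupport_subset⟩

/-- The product of a smooth function with a test function is a test function. [folklore] -/
theorem isTestFunctionOn_smooth_mul {U : Opens ℝ³} {c θ : ℝ³ → ℝ} (hc : ContDiff ℝ (⊤ : ℕ∞) c)
    (hθ : IsTestFunctionOn U θ) : IsTestFunctionOn U fun y => c y * θ y :=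
  ⟨hc.mul hθ.contDiff, hθ.hasCompactSupport.mul_left,
    (tsupport_mul_subset_right (f := c) (g := θ)).trans hθ.tsupport_subset⟩

/-- `⟪x, y⟫ = ∑ᵢ xᵢ yᵢ` in `ℝ³`. [folklore] -/
theorem inner_eq_sum_coord_mul (x y : ℝ³) : ⟪x, y⟫ = ∑ i, x i * y i := by
  conv_lhs => rw [eq_sum_coord_smul_single x]
  exact inner_sum_smul_single _ _

/-- Evaluation `(G, f) ↦ G f` of an a.e.-strongly measurable field of linear maps of `ℝ³` at an
a.e.-strongly measurable vector field is a.e.-strongly measurable (the `ℝ³` instance of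
`aestronglyMeasurable_clm_apply` of `FluidPDE/EulerSymmetricGradient`, restated to keep the
import closure small). [folklore] -/
theorem aestronglyMeasurable_clm_apply_fin3 {X : Type*} [MeasurableSpace X] {μ : Measure X}
    {G : X → ℝ³ →L[ℝ] ℝ³} {f : X → ℝ³} (hG : AEStronglyMeasurable G μ)
    (hf : AEStronglyMeasurable f μ) : AEStronglyMeasurable (fun x => G x (f x)) μ :=
  ((isBoundedBilinearMap_apply (𝕜 := ℝ) (E := ℝ³) (F := ℝ³)).continuous.comp_aestronglyMeasurable
    (hG.prodMk hf) :)

variable {x₀ : ℝ³} {ρ : ℝ} {v : ℝ³ → ℝ³} {g : ℝ³ → ℝ³ →L[ℝ] ℝ³}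

/-! ### The product rule tested coordinate-wise -/

/-- **One coordinate pair of the weak product rule.** If `v` has weak gradient `g` on a ball,
`c` is smooth and `θ` is a test function on the ball, then testing the weak derivative of `vᵢ`
with the test function `c θ` in the direction `a` gives
`∫ ((∂ₐc) θ vᵢ + c (∂ₐθ) vᵢ + c θ (g a)ᵢ) = 0`, the integrand being integrable.
[folklore] -/
theorem integrableOn_and_setIntegral_productRule_coord
    (hv : HasWeakFDerivOn (⟨ball x₀ ρ, isOpen_ball⟩ : Opens ℝ³) volume v g)
    {c : ℝ³ → ℝ} (hc : ContDiff ℝ (⊤ : ℕ∞) c) {θ : ℝ³ → ℝ}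
    (hθ : IsTestFunctionOn (⟨ball x₀ ρ, isOpen_ball⟩ : Opens ℝ³) θ) (a : ℝ³) (i : Fin 3) :
    IntegrableOn (fun x => fderiv ℝ c x a * θ x * v x i + c x * fderiv ℝ θ x a * v x i +
      c x * θ x * g x a i) (ball x₀ ρ) volume ∧
    ∫ x in ball x₀ ρ, (fderiv ℝ c x a * θ x * v x i + c x * fderiv ℝ θ x a * v x i +
      c x * θ x * g x a i) = 0 := by
  set U : Opens ℝ³ := ⟨ball x₀ ρ, isOpen_ball⟩ with hU
  have hθ' : IsTestFunctionOn U (fun y => c y * θ y) := isTestFunctionOn_smooth_mul hc hθ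
  have hvi := hasWeakFDerivOn_coord hv i
  have hdθ' := isTestFunctionOn_fderiv_apply hθ' a
  -- the two integrable pieces
  have hA : IntegrableOn (fun x => fderiv ℝ (fun y => c y * θ y) x a * v x i) (ball x₀ ρ) volume :=
    integrableOn_test_mul (U := U) hdθ'.contDiff.continuous hdθ'.hasCompactSupport
      hdθ'.tsupport_subset hvi.locallyIntegrableOn
  have hgai : LocallyIntegrableOn (fun x => g x a i) (ball x₀ ρ) volume :=
    ((EuclideanSpace.proj i).comp (ContinuousLinearMap.apply ℝ ℝ³ a)).locallyIntegrableOn_comp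
      hv.locallyIntegrableOn_deriv
  have hC : IntegrableOn (fun x => (c x * θ x) * g x a i) (ball x₀ ρ) volume :=
    integrableOn_test_mul (U := U) hθ'.contDiff.continuous hθ'.hasCompactSupport
      hθ'.tsupport_subset hgai
  -- the weak-derivative identity for `vᵢ` tested with `c θ`
  have key : ∫ x in ball x₀ ρ, fderiv ℝ (fun y => c y * θ y) x a * v x i =
      -∫ x in ball x₀ ρ, (c x * θ x) * g x a i := by
    have h := hvi.integral_fderiv_smul_eq (fun y => c y * θ y) a hθ'
    simp only [smul_eq_mul] at h
    exact h
  -- the classical product rule for `c θ`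
  have hprod : ∀ x, fderiv ℝ (fun y => c y * θ y) x a = fderiv ℝ c x a * θ x + c x * fderiv ℝ θ x a := by
    intro x
    have hcd : DifferentiableAt ℝ c x := (hc.differentiable (by simp)).differentiableAt
    have hθd : DifferentiableAt ℝ θ x := (hθ.contDiff.differentiable (by simp)).differentiableAt
    rw [fderiv_fun_mul hcd hθd]
    simp only [_root_.add_apply, _root_.FunLike.coe_smul, Pi.smul_apply, smul_eq_mul]
    ring
  have heq : (fun x => fderiv ℝ c x a * θ x * v x i + c x * fderiv ℝ θ x a * v x i +
      c x * θ x * g x a i) =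
      fun x => fderiv ℝ (fun y => c y * θ y) x a * v x i + (c x * θ x) * g x a i := by
    funext x
    rw [hprod x]
    ring
  rw [heq]
  refine ⟨hA.add hC, ?_⟩
  rw [integral_add hA hC, key]
  ring

/-- **The weak product rule tested with a vector-weighted test field.** If `v` has weak gradient
`g` on a ball, `w` is a smooth vector field and `φ` a test field on the ball, then
`∫ (⟪v, Dφ(w)⟫ + tr(Dw) ⟪v, φ⟫ + ⟪g w, φ⟫) = 0` (sum over `i, j` of
`integrableOn_and_setIntegral_productRule_coord` with `c = wⱼ`, `θ = φᵢ`, `a = eⱼ`), and the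
integrand is integrable. [folklore] -/
theorem integrableOn_and_setIntegral_productRule
    (hv : HasWeakFDerivOn (⟨ball x₀ ρ, isOpen_ball⟩ : Opens ℝ³) volume v g)
    {w : ℝ³ → ℝ³} (hw : ContDiff ℝ (⊤ : ℕ∞) w) {φ : ℝ³ → ℝ³}
    (hφ : IsTestFunctionOn (⟨ball x₀ ρ, isOpen_ball⟩ : Opens ℝ³) φ) :
    IntegrableOn (fun x => ⟪v x, fderiv ℝ φ x (w x)⟫ +
      traceCoord (fderiv ℝ w x) * ⟪v x, φ x⟫ + ⟪g x (w x), φ x⟫) (ball x₀ ρ) volume ∧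
    ∫ x in ball x₀ ρ, (⟪v x, fderiv ℝ φ x (w x)⟫ +
      traceCoord (fderiv ℝ w x) * ⟪v x, φ x⟫ + ⟪g x (w x), φ x⟫) = 0 := by
  -- the coordinate pieces
  set f : Fin 3 → Fin 3 → ℝ³ → ℝ := fun i j x =>
    fderiv ℝ (fun y => w y j) x (𝐞 j) * φ x i * v x i +
      w x j * fderiv ℝ (fun y => φ y i) x (𝐞 j) * v x i + w x j * φ x i * g x (𝐞 j) i with hf
  have hij : ∀ i j, IntegrableOn (f i j) (ball x₀ ρ) volume ∧ ∫ x in ball x₀ ρ, f i j x = 0 :=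
    fun i j => integrableOn_and_setIntegral_productRule_coord hv (contDiff_euclidean.1 hw j)
      (isTestFunctionOn_coord hφ i) (𝐞 j) i
  -- pointwise identification of the double sum
  have hwd : ∀ x, DifferentiableAt ℝ w x := fun x => (hw.differentiable (by simp)).differentiableAt
  have hφd : ∀ x, DifferentiableAt ℝ φ x := fun x =>
    (hφ.contDiff.differentiable (by simp)).differentiableAt
  have hsum : ∀ x, ∑ i, ∑ j, f i j x = ⟪v x, fderiv ℝ φ x (w x)⟫ +
      traceCoord (fderiv ℝ w x) * ⟪v x, φ x⟫ + ⟪g x (w x), φ x⟫ := by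
    intro x
    simp only [hf, fderiv_coord_apply (hwd x), fderiv_coord_apply (hφd x)]
    rw [inner_eq_sum_coord_mul, inner_eq_sum_coord_mul (v x) (φ x),
      inner_eq_sum_coord_mul (g x (w x)) (φ x), traceCoord_apply]
    simp only [clm_apply_coord (fderiv ℝ φ x) (w x), clm_apply_coord (g x) (w x),
      Fin.sum_univ_three]
    ring
  have hfun : (fun x => ⟪v x, fderiv ℝ φ x (w x)⟫ +
      traceCoord (fderiv ℝ w x) * ⟪v x, φ x⟫ + ⟪g x (w x), φ x⟫) = fun x => ∑ i, ∑ j, f i j x :=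
    funext fun x => (hsum x).symm
  rw [hfun]
  refine ⟨integrable_finsetSum _ fun i _ => integrable_finsetSum _ fun j _ => (hij i j).1, ?_⟩
  rw [integral_finsetSum _ fun i _ => integrable_finsetSum _ fun j _ => (hij i j).1]
  refine Finset.sum_eq_zero fun i _ => ?_
  rw [integral_finsetSum _ fun j _ => (hij i j).1]
  exact Finset.sum_eq_zero fun j _ => (hij i j).2

/-! ### Mollified fields with vanishing trace -/

/-- If `tr g = 0` a.e. on the ball (`v` weakly divergence free), the interior mollifications of
`𝟙_B v` are divergence free where the mollifier fits: `tr D(k ⋆ 𝟙_B v)(x) = ∫ k(x-y) tr g(y) dy = 0`.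
[folklore] -/
theorem traceCoord_fderiv_mollified_eq_zero
    (hv : HasWeakFDerivOn (⟨ball x₀ ρ, isOpen_ball⟩ : Opens ℝ³) volume v g)
    (hvI : IntegrableOn v (ball x₀ ρ) volume) (hgI : IntegrableOn g (ball x₀ ρ) volume)
    (htr : ∀ᵐ x ∂(volume.restrict (ball x₀ ρ)), ∑ j, g x (𝐞 j) j = 0) (k : ContDiffBump (0 : ℝ³))
    {x : ℝ³} (hx : closedBall x k.rOut ⊆ ball x₀ ρ) :
    traceCoord (fderiv ℝ (k.normed volume ⋆[ContinuousLinearMap.lsmul ℝ ℝ, volume]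
      (ball x₀ ρ).indicator v) x) = 0 := by
  have hD := hv.hasFDerivAt_normed_convolution_indicator hvI hgI k hx
  rw [Opens.coe_mk] at hD
  rw [hD.fderiv]
  -- the integrand `k(x - y) • g y` is integrable on the ball
  have hψ := isTestFunctionOn_normed_comp_sub (U := (⟨ball x₀ ρ, isOpen_ball⟩ : Opens ℝ³))
    (μ := volume) k hx
  obtain ⟨C, hC⟩ := hψ.contDiff.continuous.bounded_above_of_compact_support hψ.hasCompactSupport
  have hint : Integrable (fun y => k.normed volume (x - y) • g y)
      (volume.restrict (ball x₀ ρ)) :=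
    hgI.bdd_smul C hψ.contDiff.continuous.aestronglyMeasurable (ae_of_all _ hC)
  have hcomm := (traceCoord.integral_comp_comm hint).symm
  rw [show (∫ y in ball x₀ ρ, k.normed volume (x - y) • g y) =
      ∫ y, k.normed volume (x - y) • g y ∂(volume.restrict (ball x₀ ρ)) from rfl, hcomm]
  refine integral_eq_zero_of_ae ?_
  filter_upwards [htr] with y hy
  simp [map_smul, traceCoord_apply, hy]

/-! ### The weak product rule for a bounded field -/

/-- **`∫ ⟪v, (v·∇)φ⟫ = -∫ ⟪(∇v) v, φ⟫` for a bounded weakly differentiable, weakly divergence-free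
field on a ball** (the identification of the distribution `-div (v ⊗ v)` with the function
`-(v·∇)v = -(∇v) v`, Gilbarg–Trudinger (7.18)-type product rule): `v ∈ L^∞(B)` with an integrable
weak gradient `g = ∇v` on the ball `B` and `tr g = 0` a.e., `φ ∈ C_c^∞(B; ℝ³)`. Proof: mollify
`𝟙_B v` to smooth fields `wₙ`, bounded by the same constant, converging to `v` a.e. on `B`, and
divergence free on `supp φ` for large `n` (`traceCoord_fderiv_mollified_eq_zero`); the identity
`∫ (⟪v, Dφ(wₙ)⟫ + ⟪g wₙ, φ⟫) = 0` (`integrableOn_and_setIntegral_productRule`) passes to the limit by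
dominated convergence. [folklore] -/
theorem setIntegral_inner_fderiv_apply_self_eq_neg
    (hv : HasWeakFDerivOn (⟨ball x₀ ρ, isOpen_ball⟩ : Opens ℝ³) volume v g) {M : ℝ} (hM0 : 0 ≤ M)
    (hM : ∀ᵐ x ∂(volume.restrict (ball x₀ ρ)), ‖v x‖ ≤ M)
    (hgI : IntegrableOn g (ball x₀ ρ) volume)
    (htr : ∀ᵐ x ∂(volume.restrict (ball x₀ ρ)), ∑ j, g x (𝐞 j) j = 0) {φ : ℝ³ → ℝ³}
    (hφ : IsTestFunctionOn (⟨ball x₀ ρ, isOpen_ball⟩ : Opens ℝ³) φ) :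
    ∫ x in ball x₀ ρ, ⟪v x, fderiv ℝ φ x (v x)⟫ = -∫ x in ball x₀ ρ, ⟪g x (v x), φ x⟫ := by
  set B : Set ℝ³ := ball x₀ ρ with hB
  have hBm : MeasurableSet B := measurableSet_ball
  -- integrability and measurability of `v`, `g`
  have hvm : AEStronglyMeasurable v (volume.restrict B) :=
    hv.locallyIntegrableOn.aestronglyMeasurable
  have hgm : AEStronglyMeasurable g (volume.restrict B) := hgI.aestronglyMeasurable
  have hvI : IntegrableOn v B volume :=
    Integrable.mono' ((integrableOn_const_iff).2 (Or.inr measure_ball_lt_top)) hvm hM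
  -- the zero extension and its mollifications
  set vt : ℝ³ → ℝ³ := B.indicator v with hvt
  have hvtI : Integrable vt volume := hvI.integrable_indicator hBm
  have hvtli : LocallyIntegrable vt volume := hvtI.locallyIntegrable
  obtain ⟨bump, hbr, hratio⟩ := exists_contDiffBump_seq (E := ℝ³)
  set w : ℕ → ℝ³ → ℝ³ := fun n =>
    (bump n).normed volume ⋆[ContinuousLinearMap.lsmul ℝ ℝ, volume] vt with hw
  have hw_smooth : ∀ n, ContDiff ℝ (⊤ : ℕ∞) (w n) := fun n =>
    (bump n).hasCompactSupport_normed.contDiff_convolution_left _ (bump n).contDiff_normed hvtli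
  have hw_cont : ∀ n, Continuous (w n) := fun n => (hw_smooth n).continuous
  -- a.e. convergence on `B`
  have hw_tend : ∀ᵐ x ∂(volume.restrict B), Tendsto (fun n => w n x) atTop (𝓝 (v x)) := by
    have h := ae_tendsto_normed_convolution hbr hratio hvtli
    filter_upwards [ae_restrict_of_ae h, ae_restrict_mem hBm] with x hx hxB
    simpa only [hw, hvt, indicator_of_mem hxB] using hx
  -- the uniform bound `‖wₙ‖ ≤ M` a.e.
  have hvt_bd : ∀ᵐ x ∂(volume : Measure ℝ³), ‖vt x‖ ≤ M := by
    have h1 : ∀ᵐ x ∂(volume : Measure ℝ³), x ∈ B → ‖v x‖ ≤ M := (ae_restrict_iff' hBm).1 hM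
    filter_upwards [h1] with x hx
    by_cases hxB : x ∈ B
    · simpa only [hvt, indicator_of_mem hxB] using hx hxB
    · simp [hvt, indicator_of_notMem hxB, hM0]
  have hw_bd : ∀ n, ∀ᵐ x ∂(volume.restrict B), ‖w n x‖ ≤ M := by
    intro n
    have h1 : eLpNorm (w n) ∞ volume ≤ eLpNorm vt ∞ volume :=
      eLpNorm_normed_convolution_le (bump n) hvtI.aestronglyMeasurable le_top
    have h2 : eLpNorm vt ∞ volume ≤ ENNReal.ofReal M := by
      rw [eLpNorm_exponent_top]
      exact eLpNormEssSup_le_of_ae_bound hvt_bd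
    have h3 : ∀ᵐ x ∂(volume : Measure ℝ³), ‖w n x‖ₑ ≤ eLpNorm (w n) ∞ volume := by
      rw [eLpNorm_exponent_top]
      exact enorm_ae_le_eLpNormEssSup (w n) volume
    refine ae_restrict_of_ae ?_
    filter_upwards [h3] with x hx
    have h4 : ‖w n x‖ₑ ≤ ENNReal.ofReal M := hx.trans (h1.trans h2)
    rwa [← ofReal_norm, ENNReal.ofReal_le_ofReal_iff hM0] at h4
  -- room between `supp φ` and the boundary of the ball
  obtain ⟨δ, hδ, hδB⟩ :=
    hφ.hasCompactSupport.exists_cthickening_subset_open isOpen_ball hφ.tsupport_subset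
  have hN : ∀ᶠ n in atTop, (bump n).rOut < δ := hbr (gt_mem_nhds hδ)
  -- the identities for large `n`
  have hstage : ∀ᶠ n in atTop,
      ∫ x in B, (⟪v x, fderiv ℝ φ x (w n x)⟫ + ⟪g x (w n x), φ x⟫) = 0 := by
    filter_upwards [hN] with n hn
    have key := (integrableOn_and_setIntegral_productRule hv (hw_smooth n) hφ).2
    have htr0 : ∀ x, traceCoord (fderiv ℝ (w n) x) * ⟪v x, φ x⟫ = 0 := by
      intro x
      by_cases hx : x ∈ tsupport φ
      · have hsub : closedBall x (bump n).rOut ⊆ B :=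
          (closedBall_subset_cthickening hx _).trans ((cthickening_mono hn.le _).trans hδB)
        rw [traceCoord_fderiv_mollified_eq_zero hv hvI hgI htr (bump n) hsub, zero_mul]
      · rw [image_eq_zero_of_notMem_tsupport hx, inner_zero_right, mul_zero]
    have heq : (fun x => ⟪v x, fderiv ℝ φ x (w n x)⟫ +
        traceCoord (fderiv ℝ (w n) x) * ⟪v x, φ x⟫ + ⟪g x (w n x), φ x⟫) =
        fun x => ⟪v x, fderiv ℝ φ x (w n x)⟫ + ⟪g x (w n x), φ x⟫ := by
      funext x
      rw [htr0 x, add_zero]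
    rwa [heq] at key
  -- bounds for the test field
  obtain ⟨Cφ, hCφ⟩ := hφ.contDiff.continuous.bounded_above_of_compact_support hφ.hasCompactSupport
  have hDφc : Continuous (fderiv ℝ φ) := hφ.contDiff.continuous_fderiv (by simp)
  obtain ⟨CD, hCD⟩ := hDφc.bounded_above_of_compact_support (hφ.hasCompactSupport.fderiv ℝ)
  -- dominated convergence
  have hlim : Tendsto (fun n => ∫ x in B, (⟪v x, fderiv ℝ φ x (w n x)⟫ + ⟪g x (w n x), φ x⟫))
      atTop (𝓝 (∫ x in B, (⟪v x, fderiv ℝ φ x (v x)⟫ + ⟪g x (v x), φ x⟫))) := by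
    refine tendsto_integral_of_dominated_convergence
      (fun x => ‖v x‖ * (CD * M) + ‖g x‖ * M * Cφ) (fun n => ?_) ?_ (fun n => ?_) ?_
    · exact (hvm.inner ((hDφc.clm_apply (hw_cont n)).aestronglyMeasurable)).add
        ((aestronglyMeasurable_clm_apply_fin3 hgm (hw_cont n).aestronglyMeasurable).inner
          hφ.contDiff.continuous.aestronglyMeasurable)
    · exact (hvI.norm.mul_const _).add ((hgI.norm.mul_const _).mul_const _)
    · filter_upwards [hw_bd n] with x hx
      calc ‖⟪v x, fderiv ℝ φ x (w n x)⟫ + ⟪g x (w n x), φ x⟫‖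
          ≤ ‖⟪v x, fderiv ℝ φ x (w n x)⟫‖ + ‖⟪g x (w n x), φ x⟫‖ := norm_add_le _ _
        _ ≤ ‖v x‖ * ‖fderiv ℝ φ x (w n x)‖ + ‖g x (w n x)‖ * ‖φ x‖ :=
            add_le_add (norm_inner_le_norm _ _) (norm_inner_le_norm _ _)
        _ ≤ ‖v x‖ * (CD * M) + ‖g x‖ * M * Cφ := by
            gcongr
            · exact (ContinuousLinearMap.le_opNorm _ _).trans
                (mul_le_mul (hCD x) hx (norm_nonneg _) ((norm_nonneg _).trans (hCD x)))
            · calc ‖g x (w n x)‖ ≤ ‖g x‖ * ‖w n x‖ := ContinuousLinearMap.le_opNorm _ _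
                _ ≤ ‖g x‖ * M := by gcongr
            · exact hCφ x
    · filter_upwards [hw_tend] with x hx
      have h1 : Tendsto (fun n => fderiv ℝ φ x (w n x)) atTop (𝓝 (fderiv ℝ φ x (v x))) :=
        ((fderiv ℝ φ x).continuous.tendsto _).comp hx
      have h2 : Tendsto (fun n => g x (w n x)) atTop (𝓝 (g x (v x))) :=
        ((g x).continuous.tendsto _).comp hx
      exact (tendsto_const_nhds.inner h1).add (h2.inner tendsto_const_nhds)
  have hzero : ∫ x in B, (⟪v x, fderiv ℝ φ x (v x)⟫ + ⟪g x (v x), φ x⟫) = 0 := by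
    refine tendsto_nhds_unique hlim ?_
    exact tendsto_const_nhds.congr' (hstage.mono fun n hn => hn.symm)
  -- split the integral
  have hI1 : IntegrableOn (fun x => ⟪v x, fderiv ℝ φ x (v x)⟫) B volume := by
    refine Integrable.mono' (hvI.norm.mul_const (CD * M))
      (hvm.inner (aestronglyMeasurable_clm_apply_fin3 hDφc.aestronglyMeasurable hvm)) ?_
    filter_upwards [hM] with x hx
    exact (norm_inner_le_norm _ _).trans (mul_le_mul_of_nonneg_left
      ((ContinuousLinearMap.le_opNorm _ _).trans
        (mul_le_mul (hCD x) hx (norm_nonneg _) ((norm_nonneg _).trans (hCD x)))) (norm_nonneg _))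
  have hI2 : IntegrableOn (fun x => ⟪g x (v x), φ x⟫) B volume := by
    refine Integrable.mono' ((hgI.norm.mul_const M).mul_const Cφ)
      ((aestronglyMeasurable_clm_apply_fin3 hgm hvm).inner
        hφ.contDiff.continuous.aestronglyMeasurable) ?_
    filter_upwards [hM] with x hx
    calc ‖⟪g x (v x), φ x⟫‖ ≤ ‖g x (v x)‖ * ‖φ x‖ := norm_inner_le_norm _ _
      _ ≤ ‖g x‖ * M * Cφ := by
          gcongr
          · calc ‖g x (v x)‖ ≤ ‖g x‖ * ‖v x‖ := ContinuousLinearMap.le_opNorm _ _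
              _ ≤ ‖g x‖ * M := by gcongr
          · exact hCφ x
  rw [integral_add hI1 hI2] at hzero
  linarith

end ConvSlice

end Literature.Analysis.FluidPDE
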